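import Literature.NumberTheory.Automorphic.ModularLambdaCovering
import Mathlib.Analysis.Real.Cardinality
import HarnessLib

/-!
# Rigidity of the deck group of `λ`: a Möbius transformation preserving `λ` is `± γ`, `γ ∈ Γ(2)`

PROOF-ONLY sequel (no definition, no named fact) of `ModularLambdaCovering.lean` (the fibres of
`λ : ℍ → ℂ ∖ {0, 1}` are the `Γ(2)`-orbits, `modularLambda_eq_modularLambda_iff`).

★ `exists_mem_Gamma_two_eq_smul_of_forall_modularLambda_smul_eq` — if `g ∈ GL₂(ℝ)⁺` satisfies
`λ(g • τ) = λ(τ)` for every `τ ∈ ℍ`, then `g = r · γ` for some `γ ∈ Γ(2)` and a real scalar `r`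
(so `g` acts on `ℍ` as an element of `Γ(2)`): every `τ` lies in one of the countably many closed
sets `{τ | γ • τ = g • τ}`, `γ ∈ Γ(2)`; since `ℍ` is uncountable one of them has two points, and a
Möbius transformation of positive determinant with two fixed points in `ℍ` is scalar
(`eq_scalar_of_smul_eq_of_smul_eq`). This is the statement "the group of deck transformations
of the universal covering `λ : ℍ → ℂ ∖ {0,1}` is `Γ(2)/{±1}`" in the form needed for the degree
computation `[M_N : M_2] = ½[Γ(2) : Γ(N)]` of Calegari–Dimitrov–Tang (stabilisers of the dilates
`λ(N'τ)`, `λ(τ/N')` inside `Γ(2)`).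

## References
* [CalegariDimitrovTang2025] F. Calegari, V. Dimitrov, Y. Tang, J. Amer. Math. Soc. 38 (2025),
  §4.2, display (4.3.3) and its proof sketch ("the degree of `M_N` over `M_2` is equal to the degree
  of the modular curve `Y(N)` over `Y(2)`").
* [AhlforsCA1979] L. V. Ahlfors, Complex Analysis, 3rd ed., Ch. 7 §3.4 (the modular function `λ`).
-/

noncomputable section

open Complex UpperHalfPlane CongruenceSubgroup Matrix.SpecialLinearGroup Set
open scoped MatrixGroups

namespace Literature.NumberTheory.Automorphic

namespace ModularLambda

/-- **A Möbius transformation of positive determinant fixing two distinct points of `ℍ` is a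
scalar matrix** (`c τ² + (d - a) τ - b = 0` at two points of `ℍ` forces `c = 0`, `a = d`,
`b = 0`). [cite: AhlforsCA1979, Ch. 7 §3.4] -/
theorem eq_scalar_of_smul_eq_of_smul_eq {h : GL (Fin 2) ℝ} (hdet : 0 < h.det.val) {τ₁ τ₂ : ℍ}
    (hne : τ₁ ≠ τ₂) (h₁ : h • τ₁ = τ₁) (h₂ : h • τ₂ = τ₂) :
    (h : Matrix (Fin 2) (Fin 2) ℝ) = (h 0 0 : ℝ) • (1 : Matrix (Fin 2) (Fin 2) ℝ) := by
  -- the fixed-point equations `c τ² + d τ = a τ + b`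
  have key : ∀ τ : ℍ, h • τ = τ →
      (h 1 0 : ℂ) * (τ : ℂ) * τ + (h 1 1 : ℂ) * τ = (h 0 0 : ℂ) * τ + (h 0 1 : ℂ) := by
    intro τ hτ
    have e := congrArg (fun z : ℍ ↦ (z : ℂ)) hτ
    simp only [coe_smul_of_det_pos hdet] at e
    rw [div_eq_iff (denom_ne_zero h τ)] at e
    simp only [num, denom] at e
    linear_combination -e
  have e₁ := key τ₁ h₁
  have e₂ := key τ₂ h₂
  have hne' : (τ₁ : ℂ) - τ₂ ≠ 0 := sub_ne_zero.mpr fun e ↦ hne (UpperHalfPlane.ext e)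
  -- subtract: `c (τ₁ + τ₂) + d - a = 0`
  have e₃ : (h 1 0 : ℂ) * ((τ₁ : ℂ) + τ₂) + ((h 1 1 : ℂ) - h 0 0) = 0 := by
    have : ((h 1 0 : ℂ) * ((τ₁ : ℂ) + τ₂) + ((h 1 1 : ℂ) - h 0 0)) * ((τ₁ : ℂ) - τ₂) = 0 := by
      linear_combination e₁ - e₂
    exact (mul_eq_zero.mp this).resolve_right hne'
  -- imaginary part: `c (Im τ₁ + Im τ₂) = 0`, so `c = 0`
  have hc : (h 1 0 : ℝ) = 0 := by
    have him := congrArg Complex.im e₃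
    simp only [add_im, mul_im, ofReal_re, ofReal_im, zero_mul, add_zero, sub_im,
      zero_im, sub_self] at him
    have hpos : 0 < (τ₁ : ℂ).im + (τ₂ : ℂ).im := add_pos τ₁.im_pos τ₂.im_pos
    rcases mul_eq_zero.mp (by linarith [him] : (h 1 0 : ℝ) * ((τ₁ : ℂ).im + (τ₂ : ℂ).im) = 0)
      with h0 | h0
    · exact h0
    · exact absurd h0 hpos.ne'
  -- then `d = a` and `b = 0`
  have hda : (h 1 1 : ℝ) = h 0 0 := by
    have hre := congrArg Complex.re e₃
    simp only [hc, ofReal_zero, zero_mul, zero_add, sub_re, ofReal_re, zero_re] at hre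
    linarith
  have hb : (h 0 1 : ℝ) = 0 := by
    have e := e₁
    rw [hc, hda] at e
    simp only [ofReal_zero, zero_mul, zero_add] at e
    have : (h 0 1 : ℂ) = 0 := by linear_combination -e
    exact_mod_cast this
  ext i j
  fin_cases i <;> fin_cases j <;> simp [hc, hda, hb]

/-- `ℍ` is uncountable. [folklore] -/
private theorem not_countable_upperHalfPlane : ¬ Countable ℍ := by
  intro hc
  let f : Ioi (0 : ℝ) → ℍ := fun y ↦ ⟨Complex.I * (y : ℝ), by
    simpa [Complex.mul_im] using (mem_Ioi.mp y.2)⟩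
  have hf : Function.Injective f := by
    intro y₁ y₂ e
    have e' := congrArg (fun z : ℍ ↦ (z : ℂ).im) e
    simp only [f] at e'
    exact Subtype.ext (by simpa using e')
  haveI : Countable (Ioi (0 : ℝ)) := hf.countable
  have h1 : (Ioi (0 : ℝ)).Countable := Set.countable_coe_iff.mp inferInstance
  have h2 := Cardinal.mk_Ioi_real 0
  rw [← Cardinal.le_aleph0_iff_set_countable, h2] at h1
  exact absurd h1 (not_le.mpr Cardinal.aleph0_lt_continuum)

/-- ★ **Rigidity of the deck group of `λ`.** If `g ∈ GL₂(ℝ)` has positive determinant and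
`λ(g • τ) = λ(τ)` for all `τ ∈ ℍ`, then `g = r · γ` for some `γ ∈ Γ(2)` and `r ∈ ℝ` (indeed
`r = ± √(det g)`): the deck transformations of `λ : ℍ → ℂ ∖ {0, 1}` are exactly `Γ(2)/{±1}`.
[cite: CalegariDimitrovTang2025, §4.2 (proof of (4.3.3): `[M_N : M_2]` is the degree of
`Y(N) → Y(2)`)] -/
theorem exists_mem_Gamma_two_eq_smul_of_forall_modularLambda_smul_eq {g : GL (Fin 2) ℝ}
    (hdet : 0 < g.det.val)
    (h : ∀ τ : ℍ, modularLambda ((g • τ : ℍ) : ℂ) = modularLambda (τ : ℂ)) :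
    ∃ γ ∈ CongruenceSubgroup.Gamma 2, ∃ r : ℝ,
      (g : Matrix (Fin 2) (Fin 2) ℝ) = r • ((mapGL ℝ γ : GL (Fin 2) ℝ) : Matrix (Fin 2) (Fin 2) ℝ) := by
  classical
  haveI : Countable (Matrix (Fin 2) (Fin 2) ℤ) := inferInstanceAs (Countable (Fin 2 → Fin 2 → ℤ))
  haveI : Countable SL(2, ℤ) :=
    inferInstanceAs (Countable {A : Matrix (Fin 2) (Fin 2) ℤ // A.det = 1})
  -- every `τ` is moved by `g` as by some `γ_τ ∈ Γ(2)`
  have hfib : ∀ τ : ℍ, ∃ γ : Gamma 2, (γ : SL(2, ℤ)) • τ = g • τ := by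
    intro τ
    obtain ⟨γ, hγ, e⟩ := modularLambda_eq_modularLambda_iff.mp (h τ).symm
    exact ⟨⟨γ, hγ⟩, e⟩
  -- some `γ` does it at two distinct points (`Γ(2)` is countable, `ℍ` is not)
  obtain ⟨γ, τ₁, τ₂, hne, h₁, h₂⟩ : ∃ (γ : Gamma 2) (τ₁ τ₂ : ℍ), τ₁ ≠ τ₂ ∧
      (γ : SL(2, ℤ)) • τ₁ = g • τ₁ ∧ (γ : SL(2, ℤ)) • τ₂ = g • τ₂ := by
    by_contra hcon
    push Not at hcon
    apply not_countable_upperHalfPlane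
    have hsub : ∀ γ : Gamma 2, ({τ : ℍ | (γ : SL(2, ℤ)) • τ = g • τ}).Subsingleton :=
      fun γ τ₁ h₁ τ₂ h₂ ↦ by_contra fun hne ↦ hcon γ τ₁ τ₂ hne h₁ h₂
    have hcov : (univ : Set ℍ) ⊆ ⋃ γ : Gamma 2, {τ : ℍ | (γ : SL(2, ℤ)) • τ = g • τ} := by
      intro τ _
      obtain ⟨γ, hγ⟩ := hfib τ
      exact mem_iUnion.mpr ⟨γ, hγ⟩
    have hcount : (univ : Set ℍ).Countable :=
      (Set.countable_iUnion fun γ ↦ (hsub γ).countable).mono hcov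
    exact Set.countable_univ_iff.mp hcount
  -- `γ⁻¹ g` fixes `τ₁, τ₂`, hence is scalar
  set k : GL (Fin 2) ℝ := (mapGL ℝ (γ : SL(2, ℤ)))⁻¹ * g with hk
  have hkdet : 0 < k.det.val := by
    rw [hk, map_mul, map_inv, Units.val_mul, Units.val_inv_eq_inv_val]
    have hγdet : ((mapGL ℝ (γ : SL(2, ℤ))).det : ℝˣ).val = 1 := by simp
    rw [hγdet, inv_one, one_mul]
    exact hdet
  have hfix : ∀ τ : ℍ, (γ : SL(2, ℤ)) • τ = g • τ → k • τ = τ := by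
    intro τ hτ
    rw [hk, mul_smul, ← hτ]
    change (mapGL ℝ (γ : SL(2, ℤ)))⁻¹ • ((mapGL ℝ (γ : SL(2, ℤ))) • τ) = τ
    rw [inv_smul_smul]
  obtain ⟨r, hr⟩ : ∃ r : ℝ, (k : Matrix (Fin 2) (Fin 2) ℝ) = r • (1 : Matrix (Fin 2) (Fin 2) ℝ) :=
    ⟨_, eq_scalar_of_smul_eq_of_smul_eq hkdet hne (hfix τ₁ h₁) (hfix τ₂ h₂)⟩
  refine ⟨γ, γ.2, r, ?_⟩
  have hg : g = mapGL ℝ (γ : SL(2, ℤ)) * k := by rw [hk, mul_inv_cancel_left]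
  rw [hg, Units.val_mul, hr, Matrix.mul_smul, Matrix.mul_one]

end ModularLambda

end Literature.NumberTheory.Automorphic

end
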